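import Summits.Parity.GeneralizedHardyLittlewood.Theorems.PrimeLevelFamEdgeMomentsBeyondDiagonalDiagRemAbelTwoSeq
import Summits.Parity.GeneralizedHardyLittlewood.Theorems.PrimeLevelFamEdgeMomentsBeyondDiagonalDiagBoseMixedRemainderId
import Summits.Parity.GeneralizedHardyLittlewood.Theorems.PrimeLevelFamEdgeMomentsBeyondDiagonalDiagBoseMixedTailRem
import Summits.Parity.GeneralizedHardyLittlewood.Theorems.PrimeLevelFamEdgeMomentsBeyondDiagonalDiagBoseMixedMoments
import HarnessLib

/-!
# Route `PrimeLevelFamEdge`, crux K_A `MomentsBeyondDiagonal` (stmt-Parity-20007), line «petersson_layers» v4, stub `stub_diag`: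
# **the two-sequence Abel estimate for the continued Bose remainders `r_ab`, `(a,b) ∈ {0,1}²`, in `Π`-form**

Second brick of the remainder estimate (R) of order `(1,1)` (hypothesis `hR` of
`…DiagDecorOrderOneOneAssembly.orderOneOne_target_of_remainder`, p826053). `…DiagCornerBoseRem.abs_doubleSum_bose_rem_le`
(one coefficient sequence, KMV form of the continued remainder) is redone with TWO sequences
(`…DiagRemAbelTwoSeq.abs_doubleSum_sqrt_log_weight_le₂`) and then specialised to the four orders `(a,b) ∈ {0,1}²` with the
remainder written in the `Π`-form of (R): `r_ab(y) = c_ab(y) − Π_ab(log(1/y))`, `Π₀₀ = L/2 + E₀₀`, `Π₀₁ = Π₁₀-shape = −L²/8 + E`,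
`Π₁₁ = L³/24 − 2μ₂L + E₁₁` (`μ₀ = ∫₀¹ v/(1+v²)² = 1/4`, `…DiagBoseMixedMoments.integral_model_weight_Ioc`; the `μ₁`-terms cancel):

* `abs_doubleSum_bose_rem_le₂` — general `(a,b)`, two sequences, KMV form;
* `envelope_aux` — `3(C₀ + C₀x^N) + 2C₀ + C₀x^N·x ≤ 9C₀x⁴` (`x ≥ 1`, `N ≤ 3`);
* `abs_doubleSum_rem_le₂` — **ONE set of constants `E₀₀, E₀₁, E₁₀, E₁₁, μ₂, C₀` such that for all admissible
  `a₁, a₂, Y, α, B, η, K₁, i, j` each of the four sums `Σ_{k₁,k₂≤Y} a₁(k₁)a₂(k₂)ℓ⁺(k₁)ⁱℓ⁺(k₂)ʲ r_ab(αk₁k₂)` is at most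
  `Sᵢ(a₁)·B·logʲY·3C₀√(2αK₁Y) + Sⱼ(a₂)·2η·logⁱY·9C₀(1+|log(2αY²)|)⁴`.**

Def-free; theorems only. Helper `--supports stmt-Parity-20007`; closes nothing; K_A, K_B and the Parity summit are NOT
proved; nothing about Landau–Siegel zeros.

## References
* E. Kowalski, P. Michel, J. VanderKam, J. reine angew. Math. 526 (2000), (22)–(28) pp. 12–15 and Prop. 5.1 p. 18.
  [cite: KowalskiMichelVanderKam2000, Prop. 5.1 — derivation (corner of the diagonal, general Q, remainder weights)]
-/

noncomputable section

open Real Set MeasureTheory Finset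

namespace Summit.Parity.GeneralizedHardyLittlewood.Theorems.MomentsBeyondDiagonal.DiagCorner

open Summit.Parity.GeneralizedHardyLittlewood.Theorems.BeyondDiagonalBeatsQuarter.Corner
open Summit.Parity.GeneralizedHardyLittlewood.Theorems.MomentsBeyondDiagonal.DiagLines

/-- **Two-sequence two-variable Abel estimate for the continued Bose remainder `r_ab` (KMV form).**
[cite: KowalskiMichelVanderKam2000, Prop. 5.1 — derivation (corner of the diagonal, general Q, remainder of the weight)] -/
theorem abs_doubleSum_bose_rem_le₂ (a b : ℕ) : ∃ C₀ : ℝ, 0 ≤ C₀ ∧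
    ∀ (a₁ a₂ : ℕ → ℝ) (Y α B η : ℝ) (K₁ i j : ℕ), 1 ≤ Y → 0 < α → 1 ≤ i → 1 ≤ j →
      (∀ e : ℕ, e ≤ ⌊Y⌋₊ → |∑ k ∈ Icc 1 e, a₂ k| ≤ B) → (∀ e : ℕ, K₁ ≤ e → |∑ k ∈ Icc 1 e, a₁ k| ≤ η) →
      2 * α * K₁ * Y ≤ 1 →
    |∑ k₁ ∈ Icc 1 ⌊Y⌋₊, ∑ k₂ ∈ Icc 1 ⌊Y⌋₊,
        a₁ k₁ * a₂ k₂ * ellp Y k₁ ^ i * ellp Y k₂ ^ j *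
          ((∫ u₁ in Ioi (0 : ℝ), Real.log u₁ ^ a *
              ∫ u₂ in Ioi ((α * k₁ * k₂) / u₁), Real.exp (-(u₁ + u₂)) / (1 - Real.exp (-(u₁ + u₂))) ^ 2 *
                Real.log u₂ ^ b) -
            ((∫ u₁ in Ioi (0 : ℝ), Real.log u₁ ^ a *
                ∫ u₂ in Ioi (1 / u₁), Real.exp (-(u₁ + u₂)) / (1 - Real.exp (-(u₁ + u₂))) ^ 2 * Real.log u₂ ^ b) +
              (∫ η in Ioc (0 : ℝ) 1, (η * (∫ u in Ioi (0 : ℝ), Real.log u ^ a * Real.log (η / u) ^ b *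
                  (Real.exp (-(u + η / u)) / (1 - Real.exp (-(u + η / u))) ^ 2) / u) -
                ∫ v in Ioc (0 : ℝ) 1, ((-(Real.log (1 / η) / 2) + Real.log v) ^ a *
                    (-(Real.log (1 / η) / 2) - Real.log v) ^ b +
                  (-(Real.log (1 / η) / 2) - Real.log v) ^ a * (-(Real.log (1 / η) / 2) + Real.log v) ^ b) *
                  (v / (1 + v ^ 2) ^ 2)) / η) +
              ∑ i' ∈ Finset.range (a + 1), ∑ j' ∈ Finset.range (b + 1),
                (a.choose i' : ℝ) * (b.choose j' : ℝ) * ((-1) ^ j' + (-1) ^ i') *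
                  (∫ v in Ioc (0 : ℝ) 1, Real.log v ^ (i' + j') * (v / (1 + v ^ 2) ^ 2)) *
                  ((-1 / 2 : ℝ) ^ (a - i' + (b - j')) * Real.log (1 / (α * k₁ * k₂)) ^ (a - i' + (b - j') + 1) /
                    (((a - i' + (b - j') : ℕ) : ℝ) + 1))))| ≤
      (∑ k ∈ Icc 1 ⌊Y⌋₊, |a₁ k| * ellp Y k ^ i) *
          (B * (Real.log Y ^ j * (3 * C₀ * Real.sqrt (2 * α * K₁ * Y)))) +
        (∑ k ∈ Icc 1 ⌊Y⌋₊, |a₂ k| * ellp Y k ^ j) * ((2 * η) * (Real.log Y ^ i *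
          (3 * (C₀ + C₀ * (1 + |Real.log (2 * α * Y ^ 2)|) ^ (a + b + 1)) + 2 * C₀ +
            C₀ * (1 + |Real.log (2 * α * Y ^ 2)|) ^ (a + b + 1) * (1 + |Real.log (2 * α * Y ^ 2)|)))) := by
  obtain ⟨C₁, hC₁⟩ := abs_bose_rem_small_le_sqrt a b
  obtain ⟨C₂, hC₂⟩ := abs_bose_rem_small_sub_le_sqrt a b
  obtain ⟨C₃, hC₃⟩ := abs_bose_rem_tail_le a b
  obtain ⟨C₄, hC₄⟩ := abs_bose_rem_tail_sub_le a b
  set C₀ : ℝ := max (max |C₁| |C₂|) (max |C₃| |C₄|) with hC₀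
  have h1 : C₁ ≤ C₀ := (le_abs_self _).trans ((le_max_left _ _).trans (le_max_left _ _))
  have h2 : C₂ ≤ C₀ := (le_abs_self _).trans ((le_max_right _ _).trans (le_max_left _ _))
  have h3 : C₃ ≤ C₀ := (le_abs_self _).trans ((le_max_left _ _).trans (le_max_right _ _))
  have h4 : C₄ ≤ C₀ := (le_abs_self _).trans ((le_max_right _ _).trans (le_max_right _ _))
  have hC₀0 : 0 ≤ C₀ := (abs_nonneg C₁).trans ((le_max_left _ _).trans (le_max_left _ _))
  refine ⟨C₀, hC₀0, fun a₁ a₂ Y α B η K₁ i j hY hα hi hj hB hη hY₁ ↦ ?_⟩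
  -- the weight as a function of `y`
  set r : ℝ → ℝ := fun y ↦ (∫ u₁ in Ioi (0 : ℝ), Real.log u₁ ^ a *
      ∫ u₂ in Ioi (y / u₁), Real.exp (-(u₁ + u₂)) / (1 - Real.exp (-(u₁ + u₂))) ^ 2 * Real.log u₂ ^ b) -
    ((∫ u₁ in Ioi (0 : ℝ), Real.log u₁ ^ a *
        ∫ u₂ in Ioi (1 / u₁), Real.exp (-(u₁ + u₂)) / (1 - Real.exp (-(u₁ + u₂))) ^ 2 * Real.log u₂ ^ b) +
      (∫ η in Ioc (0 : ℝ) 1, (η * (∫ u in Ioi (0 : ℝ), Real.log u ^ a * Real.log (η / u) ^ b *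
          (Real.exp (-(u + η / u)) / (1 - Real.exp (-(u + η / u))) ^ 2) / u) -
        ∫ v in Ioc (0 : ℝ) 1, ((-(Real.log (1 / η) / 2) + Real.log v) ^ a *
            (-(Real.log (1 / η) / 2) - Real.log v) ^ b +
          (-(Real.log (1 / η) / 2) - Real.log v) ^ a * (-(Real.log (1 / η) / 2) + Real.log v) ^ b) *
          (v / (1 + v ^ 2) ^ 2)) / η) +
      ∑ i' ∈ Finset.range (a + 1), ∑ j' ∈ Finset.range (b + 1),
        (a.choose i' : ℝ) * (b.choose j' : ℝ) * ((-1) ^ j' + (-1) ^ i') *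
          (∫ v in Ioc (0 : ℝ) 1, Real.log v ^ (i' + j') * (v / (1 + v ^ 2) ^ 2)) *
          ((-1 / 2 : ℝ) ^ (a - i' + (b - j')) * Real.log (1 / y) ^ (a - i' + (b - j') + 1) /
            (((a - i' + (b - j') : ℕ) : ℝ) + 1))) with hr
  have hS1 : ∀ y : ℝ, 0 < y → y ≤ 1 → |r y| ≤ C₀ * Real.sqrt y := by
    intro y hy0 hy1
    have h := hC₁ y hy0 hy1
    simp only [hr]
    exact h.trans (by gcongr)
  have hS2 : ∀ y₁ y₂ : ℝ, 0 < y₁ → y₁ ≤ y₂ → y₂ ≤ 1 → |r y₁ - r y₂| ≤ C₀ * (y₂ - y₁) / Real.sqrt y₁ := by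
    intro y₁ y₂ hy₁ h12 hy₂
    have h := hC₂ y₁ y₂ hy₁ h12 hy₂
    have heq : r y₁ - r y₂ = ((∫ u₁ in Ioi (0 : ℝ), Real.log u₁ ^ a *
        ∫ u₂ in Ioi (y₁ / u₁), Real.exp (-(u₁ + u₂)) / (1 - Real.exp (-(u₁ + u₂))) ^ 2 * Real.log u₂ ^ b) -
      (∫ u₁ in Ioi (0 : ℝ), Real.log u₁ ^ a *
        ∫ u₂ in Ioi (y₂ / u₁), Real.exp (-(u₁ + u₂)) / (1 - Real.exp (-(u₁ + u₂))) ^ 2 * Real.log u₂ ^ b)) -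
      ((∑ i' ∈ Finset.range (a + 1), ∑ j' ∈ Finset.range (b + 1),
        (a.choose i' : ℝ) * (b.choose j' : ℝ) * ((-1) ^ j' + (-1) ^ i') *
          (∫ v in Ioc (0 : ℝ) 1, Real.log v ^ (i' + j') * (v / (1 + v ^ 2) ^ 2)) *
          ((-1 / 2 : ℝ) ^ (a - i' + (b - j')) * Real.log (1 / y₁) ^ (a - i' + (b - j') + 1) /
            (((a - i' + (b - j') : ℕ) : ℝ) + 1))) -
      ∑ i' ∈ Finset.range (a + 1), ∑ j' ∈ Finset.range (b + 1),
        (a.choose i' : ℝ) * (b.choose j' : ℝ) * ((-1) ^ j' + (-1) ^ i') *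
          (∫ v in Ioc (0 : ℝ) 1, Real.log v ^ (i' + j') * (v / (1 + v ^ 2) ^ 2)) *
          ((-1 / 2 : ℝ) ^ (a - i' + (b - j')) * Real.log (1 / y₂) ^ (a - i' + (b - j') + 1) /
            (((a - i' + (b - j') : ℕ) : ℝ) + 1))) := by
      simp only [hr]; ring
    rw [heq]
    have hs0 : 0 < Real.sqrt y₁ := Real.sqrt_pos.2 hy₁
    have hnn : 0 ≤ (y₂ - y₁) / Real.sqrt y₁ := div_nonneg (by linarith) hs0.le
    calc _ ≤ C₂ * (y₂ - y₁) / Real.sqrt y₁ := h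
      _ = C₂ * ((y₂ - y₁) / Real.sqrt y₁) := by ring
      _ ≤ C₀ * ((y₂ - y₁) / Real.sqrt y₁) := mul_le_mul_of_nonneg_right h2 hnn
      _ = _ := by ring
  have hT1 : ∀ y : ℝ, 1 ≤ y → |r y| ≤ C₀ * (1 + Real.log y) ^ (a + b + 1) := by
    intro y hy
    have h := hC₃ y hy
    simp only [hr]
    have : 0 ≤ (1 + Real.log y) ^ (a + b + 1) := pow_nonneg (by linarith [Real.log_nonneg hy]) _
    exact h.trans (by gcongr)
  have hT2 : ∀ y₁ y₂ : ℝ, 1 ≤ y₁ → y₁ ≤ y₂ →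
      |r y₁ - r y₂| ≤ C₀ * (1 + Real.log y₂) ^ (a + b + 1) * (y₂ - y₁) / y₁ := by
    intro y₁ y₂ hy₁ h12
    have h := hC₄ y₁ y₂ hy₁ h12
    have heq : r y₁ - r y₂ = ((∫ u₁ in Ioi (0 : ℝ), Real.log u₁ ^ a *
        ∫ u₂ in Ioi (y₁ / u₁), Real.exp (-(u₁ + u₂)) / (1 - Real.exp (-(u₁ + u₂))) ^ 2 * Real.log u₂ ^ b) -
      (∫ u₁ in Ioi (0 : ℝ), Real.log u₁ ^ a *
        ∫ u₂ in Ioi (y₂ / u₁), Real.exp (-(u₁ + u₂)) / (1 - Real.exp (-(u₁ + u₂))) ^ 2 * Real.log u₂ ^ b)) -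
      ((∑ i' ∈ Finset.range (a + 1), ∑ j' ∈ Finset.range (b + 1),
        (a.choose i' : ℝ) * (b.choose j' : ℝ) * ((-1) ^ j' + (-1) ^ i') *
          (∫ v in Ioc (0 : ℝ) 1, Real.log v ^ (i' + j') * (v / (1 + v ^ 2) ^ 2)) *
          ((-1 / 2 : ℝ) ^ (a - i' + (b - j')) * Real.log (1 / y₁) ^ (a - i' + (b - j') + 1) /
            (((a - i' + (b - j') : ℕ) : ℝ) + 1))) -
      ∑ i' ∈ Finset.range (a + 1), ∑ j' ∈ Finset.range (b + 1),
        (a.choose i' : ℝ) * (b.choose j' : ℝ) * ((-1) ^ j' + (-1) ^ i') *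
          (∫ v in Ioc (0 : ℝ) 1, Real.log v ^ (i' + j') * (v / (1 + v ^ 2) ^ 2)) *
          ((-1 / 2 : ℝ) ^ (a - i' + (b - j')) * Real.log (1 / y₂) ^ (a - i' + (b - j') + 1) /
            (((a - i' + (b - j') : ℕ) : ℝ) + 1))) := by
      simp only [hr]; ring
    rw [heq]
    have hy₁0 : 0 < y₁ := one_pos.trans_le hy₁
    have hnn : 0 ≤ (1 + Real.log y₂) ^ (a + b + 1) * (y₂ - y₁) / y₁ := by
      have : 0 ≤ Real.log y₂ := Real.log_nonneg (hy₁.trans h12)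
      apply div_nonneg (mul_nonneg (pow_nonneg (by linarith) _) (by linarith)) hy₁0.le
    calc _ ≤ C₄ * (1 + Real.log y₂) ^ (a + b + 1) * (y₂ - y₁) / y₁ := h
      _ = C₄ * ((1 + Real.log y₂) ^ (a + b + 1) * (y₂ - y₁) / y₁) := by ring
      _ ≤ C₀ * ((1 + Real.log y₂) ^ (a + b + 1) * (y₂ - y₁) / y₁) := mul_le_mul_of_nonneg_right h4 hnn
      _ = _ := by ring
  have hmain := abs_doubleSum_sqrt_log_weight_le₂ (a₁ := a₁) (a₂ := a₂) (r := r) (N := a + b + 1) hY hα hi hj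
    hC₀0 hC₀0 hB hη hS1 hS2 hT1 hT2 hY₁
  have hrw : ∀ k₁ k₂ : ℕ, r (α * k₁ * k₂) = ((∫ u₁ in Ioi (0 : ℝ), Real.log u₁ ^ a *
      ∫ u₂ in Ioi ((α * k₁ * k₂) / u₁), Real.exp (-(u₁ + u₂)) / (1 - Real.exp (-(u₁ + u₂))) ^ 2 *
        Real.log u₂ ^ b) -
    ((∫ u₁ in Ioi (0 : ℝ), Real.log u₁ ^ a *
        ∫ u₂ in Ioi (1 / u₁), Real.exp (-(u₁ + u₂)) / (1 - Real.exp (-(u₁ + u₂))) ^ 2 * Real.log u₂ ^ b) +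
      (∫ η in Ioc (0 : ℝ) 1, (η * (∫ u in Ioi (0 : ℝ), Real.log u ^ a * Real.log (η / u) ^ b *
          (Real.exp (-(u + η / u)) / (1 - Real.exp (-(u + η / u))) ^ 2) / u) -
        ∫ v in Ioc (0 : ℝ) 1, ((-(Real.log (1 / η) / 2) + Real.log v) ^ a *
            (-(Real.log (1 / η) / 2) - Real.log v) ^ b +
          (-(Real.log (1 / η) / 2) - Real.log v) ^ a * (-(Real.log (1 / η) / 2) + Real.log v) ^ b) *
          (v / (1 + v ^ 2) ^ 2)) / η) +
      ∑ i' ∈ Finset.range (a + 1), ∑ j' ∈ Finset.range (b + 1),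
        (a.choose i' : ℝ) * (b.choose j' : ℝ) * ((-1) ^ j' + (-1) ^ i') *
          (∫ v in Ioc (0 : ℝ) 1, Real.log v ^ (i' + j') * (v / (1 + v ^ 2) ^ 2)) *
          ((-1 / 2 : ℝ) ^ (a - i' + (b - j')) * Real.log (1 / (α * k₁ * k₂)) ^ (a - i' + (b - j') + 1) /
            (((a - i' + (b - j') : ℕ) : ℝ) + 1)))) := fun k₁ k₂ ↦ by simp only [hr]
  simp only [hrw] at hmain
  exact hmain

/-- `3(C₀ + C₀x^N) + 2C₀ + C₀x^N·x ≤ 9C₀x⁴` for `C₀ ≥ 0`, `x ≥ 1`, `N ≤ 3`. [folklore] -/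
theorem envelope_aux {C₀ x : ℝ} (hC : 0 ≤ C₀) (hx : 1 ≤ x) {N : ℕ} (hN : N ≤ 3) :
    3 * (C₀ + C₀ * x ^ N) + 2 * C₀ + C₀ * x ^ N * x ≤ 9 * C₀ * x ^ 4 := by
  have h4 : 1 ≤ x ^ 4 := one_le_pow₀ hx
  have hN4 : x ^ N ≤ x ^ 4 := pow_le_pow_right₀ hx (by omega)
  have hN1 : x ^ N * x ≤ x ^ 4 := by
    rw [← pow_succ]; exact pow_le_pow_right₀ hx (by omega)
  nlinarith [mul_le_mul_of_nonneg_left h4 hC, mul_le_mul_of_nonneg_left hN4 hC,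
    mul_le_mul_of_nonneg_left hN1 hC]

/-- Weakening of the second term of the two-sequence estimate to the common envelope `9C₀(1+|log(2αY²)|)⁴`
(`N ≤ 3`). [folklore] -/
theorem weaken_second_term {S T Sj η L C₀ x : ℝ} {i N : ℕ} (hSj : 0 ≤ Sj) (hη : 0 ≤ η) (hL : 0 ≤ L)
    (hC : 0 ≤ C₀) (hx : 1 ≤ x) (hN : N ≤ 3)
    (h : S ≤ T + Sj * ((2 * η) * (L ^ i * (3 * (C₀ + C₀ * x ^ N) + 2 * C₀ + C₀ * x ^ N * x)))) :
    S ≤ T + Sj * ((2 * η) * (L ^ i * (9 * C₀ * x ^ 4))) := by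
  have hw := envelope_aux hC hx hN
  have : Sj * ((2 * η) * (L ^ i * (3 * (C₀ + C₀ * x ^ N) + 2 * C₀ + C₀ * x ^ N * x))) ≤
      Sj * ((2 * η) * (L ^ i * (9 * C₀ * x ^ 4))) := by
    have hLi : 0 ≤ L ^ i := pow_nonneg hL i
    gcongr
  linarith

/-- **THE FOUR CONTINUED BOSE REMAINDERS OF ORDER `(1,1)` IN `Π`-FORM, TWO-SEQUENCE ABEL ESTIMATE WITH A COMMON ENVELOPE.**
There are constants `E₀₀, E₀₁, E₁₀, E₁₁, μ₂` and `C₀ ≥ 0` such that for all real sequences `a₁, a₂`, all `Y ≥ 1`, `α > 0`,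
`i, j ≥ 1`, `B, η, K₁` with `|Σ_{k≤e}a₂(k)| ≤ B` (`e ≤ ⌊Y⌋`), `|Σ_{k≤e}a₁(k)| ≤ η` (`e ≥ K₁`), `2αK₁Y ≤ 1`, each of the sums
`Σ_{k₁,k₂≤Y} a₁(k₁)a₂(k₂)ℓ⁺(k₁)ⁱℓ⁺(k₂)ʲ·(c_ab(αk₁k₂) − Π_ab(log(1/(αk₁k₂))))`, `(a,b) ∈ {0,1}²`, is bounded in absolute value by
`Sᵢ(a₁)·B·logʲY·3C₀√(2αK₁Y) + Sⱼ(a₂)·2η·logⁱY·9C₀(1+|log(2αY²)|)⁴`.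
[cite: KowalskiMichelVanderKam2000, (22)–(28) and Prop. 5.1 — derivation (corner of the diagonal, general Q, order (1,1))] -/
theorem abs_doubleSum_rem_le₂ : ∃ E₀₀ E₀₁ E₁₀ E₁₁ μ₂ C₀ : ℝ, 0 ≤ C₀ ∧
    ∀ (a₁ a₂ : ℕ → ℝ) (Y α B η : ℝ) (K₁ i j : ℕ), 1 ≤ Y → 0 < α → 1 ≤ i → 1 ≤ j →
      (∀ e : ℕ, e ≤ ⌊Y⌋₊ → |∑ k ∈ Icc 1 e, a₂ k| ≤ B) → (∀ e : ℕ, K₁ ≤ e → |∑ k ∈ Icc 1 e, a₁ k| ≤ η) →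
      2 * α * K₁ * Y ≤ 1 →
    |∑ k₁ ∈ Icc 1 ⌊Y⌋₊, ∑ k₂ ∈ Icc 1 ⌊Y⌋₊,
        a₁ k₁ * a₂ k₂ * ellp Y k₁ ^ i * ellp Y k₂ ^ j *
          ((∫ u₁ in Ioi (0 : ℝ), ∫ u₂ in Ioi ((α * k₁ * k₂) / u₁),
              Real.exp (-(u₁ + u₂)) / (1 - Real.exp (-(u₁ + u₂))) ^ 2) -
            (Real.log (1 / (α * k₁ * k₂)) / 2 + E₀₀))| ≤
      (∑ k ∈ Icc 1 ⌊Y⌋₊, |a₁ k| * ellp Y k ^ i) * (B * (Real.log Y ^ j * (3 * C₀ * Real.sqrt (2 * α * K₁ * Y)))) +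
        (∑ k ∈ Icc 1 ⌊Y⌋₊, |a₂ k| * ellp Y k ^ j) *
          ((2 * η) * (Real.log Y ^ i * (9 * C₀ * (1 + |Real.log (2 * α * Y ^ 2)|) ^ 4))) ∧
    |∑ k₁ ∈ Icc 1 ⌊Y⌋₊, ∑ k₂ ∈ Icc 1 ⌊Y⌋₊,
        a₁ k₁ * a₂ k₂ * ellp Y k₁ ^ i * ellp Y k₂ ^ j *
          ((∫ u₁ in Ioi (0 : ℝ), ∫ u₂ in Ioi ((α * k₁ * k₂) / u₁),
              Real.exp (-(u₁ + u₂)) / (1 - Real.exp (-(u₁ + u₂))) ^ 2 * Real.log u₂) -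
            (-(Real.log (1 / (α * k₁ * k₂)) ^ 2) / 8 + E₀₁))| ≤
      (∑ k ∈ Icc 1 ⌊Y⌋₊, |a₁ k| * ellp Y k ^ i) * (B * (Real.log Y ^ j * (3 * C₀ * Real.sqrt (2 * α * K₁ * Y)))) +
        (∑ k ∈ Icc 1 ⌊Y⌋₊, |a₂ k| * ellp Y k ^ j) *
          ((2 * η) * (Real.log Y ^ i * (9 * C₀ * (1 + |Real.log (2 * α * Y ^ 2)|) ^ 4))) ∧
    |∑ k₁ ∈ Icc 1 ⌊Y⌋₊, ∑ k₂ ∈ Icc 1 ⌊Y⌋₊,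
        a₁ k₁ * a₂ k₂ * ellp Y k₁ ^ i * ellp Y k₂ ^ j *
          ((∫ u₁ in Ioi (0 : ℝ), Real.log u₁ * ∫ u₂ in Ioi ((α * k₁ * k₂) / u₁),
              Real.exp (-(u₁ + u₂)) / (1 - Real.exp (-(u₁ + u₂))) ^ 2) -
            (-(Real.log (1 / (α * k₁ * k₂)) ^ 2) / 8 + E₁₀))| ≤
      (∑ k ∈ Icc 1 ⌊Y⌋₊, |a₁ k| * ellp Y k ^ i) * (B * (Real.log Y ^ j * (3 * C₀ * Real.sqrt (2 * α * K₁ * Y)))) +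
        (∑ k ∈ Icc 1 ⌊Y⌋₊, |a₂ k| * ellp Y k ^ j) *
          ((2 * η) * (Real.log Y ^ i * (9 * C₀ * (1 + |Real.log (2 * α * Y ^ 2)|) ^ 4))) ∧
    |∑ k₁ ∈ Icc 1 ⌊Y⌋₊, ∑ k₂ ∈ Icc 1 ⌊Y⌋₊,
        a₁ k₁ * a₂ k₂ * ellp Y k₁ ^ i * ellp Y k₂ ^ j *
          ((∫ u₁ in Ioi (0 : ℝ), Real.log u₁ * ∫ u₂ in Ioi ((α * k₁ * k₂) / u₁),
              Real.exp (-(u₁ + u₂)) / (1 - Real.exp (-(u₁ + u₂))) ^ 2 * Real.log u₂) -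
            (Real.log (1 / (α * k₁ * k₂)) ^ 3 / 24 - 2 * μ₂ * Real.log (1 / (α * k₁ * k₂)) + E₁₁))| ≤
      (∑ k ∈ Icc 1 ⌊Y⌋₊, |a₁ k| * ellp Y k ^ i) * (B * (Real.log Y ^ j * (3 * C₀ * Real.sqrt (2 * α * K₁ * Y)))) +
        (∑ k ∈ Icc 1 ⌊Y⌋₊, |a₂ k| * ellp Y k ^ j) *
          ((2 * η) * (Real.log Y ^ i * (9 * C₀ * (1 + |Real.log (2 * α * Y ^ 2)|) ^ 4))) := by
  obtain ⟨C₀₀, hC₀₀, h₀₀⟩ := abs_doubleSum_bose_rem_le₂ 0 0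
  obtain ⟨C₀₁, hC₀₁, h₀₁⟩ := abs_doubleSum_bose_rem_le₂ 0 1
  obtain ⟨C₁₀, hC₁₀, h₁₀⟩ := abs_doubleSum_bose_rem_le₂ 1 0
  obtain ⟨C₁₁, hC₁₁, h₁₁⟩ := abs_doubleSum_bose_rem_le₂ 1 1
  set C₀ : ℝ := max (max C₀₀ C₀₁) (max C₁₀ C₁₁) with hC₀
  have e₀₀ : C₀₀ ≤ C₀ := (le_max_left _ _).trans (le_max_left _ _)
  have e₀₁ : C₀₁ ≤ C₀ := (le_max_right _ _).trans (le_max_left _ _)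
  have e₁₀ : C₁₀ ≤ C₀ := (le_max_left _ _).trans (le_max_right _ _)
  have e₁₁ : C₁₁ ≤ C₀ := (le_max_right _ _).trans (le_max_right _ _)
  have hC₀0 : 0 ≤ C₀ := hC₀₀.trans e₀₀
  -- the constants `E_ab = c_ab(1) + A_ab` and `μ₂`
  refine ⟨(∫ u₁ in Ioi (0 : ℝ), Real.log u₁ ^ 0 * ∫ u₂ in Ioi (1 / u₁),
        Real.exp (-(u₁ + u₂)) / (1 - Real.exp (-(u₁ + u₂))) ^ 2 * Real.log u₂ ^ 0) +
      (∫ η in Ioc (0 : ℝ) 1, (η * (∫ u in Ioi (0 : ℝ), Real.log u ^ 0 * Real.log (η / u) ^ 0 *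
            (Real.exp (-(u + η / u)) / (1 - Real.exp (-(u + η / u))) ^ 2) / u) -
          ∫ v in Ioc (0 : ℝ) 1, ((-(Real.log (1 / η) / 2) + Real.log v) ^ 0 * (-(Real.log (1 / η) / 2) - Real.log v) ^ 0 +
              (-(Real.log (1 / η) / 2) - Real.log v) ^ 0 * (-(Real.log (1 / η) / 2) + Real.log v) ^ 0) *
            (v / (1 + v ^ 2) ^ 2)) / η),
    (∫ u₁ in Ioi (0 : ℝ), Real.log u₁ ^ 0 * ∫ u₂ in Ioi (1 / u₁),
        Real.exp (-(u₁ + u₂)) / (1 - Real.exp (-(u₁ + u₂))) ^ 2 * Real.log u₂ ^ 1) +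
      (∫ η in Ioc (0 : ℝ) 1, (η * (∫ u in Ioi (0 : ℝ), Real.log u ^ 0 * Real.log (η / u) ^ 1 *
            (Real.exp (-(u + η / u)) / (1 - Real.exp (-(u + η / u))) ^ 2) / u) -
          ∫ v in Ioc (0 : ℝ) 1, ((-(Real.log (1 / η) / 2) + Real.log v) ^ 0 * (-(Real.log (1 / η) / 2) - Real.log v) ^ 1 +
              (-(Real.log (1 / η) / 2) - Real.log v) ^ 0 * (-(Real.log (1 / η) / 2) + Real.log v) ^ 1) *
            (v / (1 + v ^ 2) ^ 2)) / η),
    (∫ u₁ in Ioi (0 : ℝ), Real.log u₁ ^ 1 * ∫ u₂ in Ioi (1 / u₁),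
        Real.exp (-(u₁ + u₂)) / (1 - Real.exp (-(u₁ + u₂))) ^ 2 * Real.log u₂ ^ 0) +
      (∫ η in Ioc (0 : ℝ) 1, (η * (∫ u in Ioi (0 : ℝ), Real.log u ^ 1 * Real.log (η / u) ^ 0 *
            (Real.exp (-(u + η / u)) / (1 - Real.exp (-(u + η / u))) ^ 2) / u) -
          ∫ v in Ioc (0 : ℝ) 1, ((-(Real.log (1 / η) / 2) + Real.log v) ^ 1 * (-(Real.log (1 / η) / 2) - Real.log v) ^ 0 +
              (-(Real.log (1 / η) / 2) - Real.log v) ^ 1 * (-(Real.log (1 / η) / 2) + Real.log v) ^ 0) *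
            (v / (1 + v ^ 2) ^ 2)) / η),
    (∫ u₁ in Ioi (0 : ℝ), Real.log u₁ ^ 1 * ∫ u₂ in Ioi (1 / u₁),
        Real.exp (-(u₁ + u₂)) / (1 - Real.exp (-(u₁ + u₂))) ^ 2 * Real.log u₂ ^ 1) +
      (∫ η in Ioc (0 : ℝ) 1, (η * (∫ u in Ioi (0 : ℝ), Real.log u ^ 1 * Real.log (η / u) ^ 1 *
            (Real.exp (-(u + η / u)) / (1 - Real.exp (-(u + η / u))) ^ 2) / u) -
          ∫ v in Ioc (0 : ℝ) 1, ((-(Real.log (1 / η) / 2) + Real.log v) ^ 1 * (-(Real.log (1 / η) / 2) - Real.log v) ^ 1 +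
              (-(Real.log (1 / η) / 2) - Real.log v) ^ 1 * (-(Real.log (1 / η) / 2) + Real.log v) ^ 1) *
            (v / (1 + v ^ 2) ^ 2)) / η),
    ∫ v in Ioc (0 : ℝ) 1, Real.log v ^ (1 + 1) * (v / (1 + v ^ 2) ^ 2),
    C₀, hC₀0, fun a₁ a₂ Y α B η K₁ i j hY hα hi hj hB hη hY₁ ↦ ?_⟩
  have hY0 : 0 < Y := by linarith
  -- common data for the weakening step
  have hη0 : 0 ≤ η := (abs_nonneg _).trans (hη K₁ le_rfl)
  have hLY : 0 ≤ Real.log Y := Real.log_nonneg hY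
  have hx : (1 : ℝ) ≤ 1 + |Real.log (2 * α * Y ^ 2)| := by linarith [abs_nonneg (Real.log (2 * α * Y ^ 2))]
  have hSj : 0 ≤ ∑ k ∈ Icc 1 ⌊Y⌋₊, |a₂ k| * ellp Y k ^ j :=
    Finset.sum_nonneg fun k _ ↦ mul_nonneg (abs_nonneg _) (pow_nonneg (ellp_nonneg Y k) j)
  have hSi : 0 ≤ ∑ k ∈ Icc 1 ⌊Y⌋₊, |a₁ k| * ellp Y k ^ i :=
    Finset.sum_nonneg fun k _ ↦ mul_nonneg (abs_nonneg _) (pow_nonneg (ellp_nonneg Y k) i)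
  have hB0 : 0 ≤ B := (abs_nonneg _).trans (hB 0 (Nat.zero_le _))
  have hsq : 0 ≤ Real.sqrt (2 * α * K₁ * Y) := Real.sqrt_nonneg _
  -- enlarge the constant of the first term
  have hfirst : ∀ {C : ℝ}, C ≤ C₀ →
      (∑ k ∈ Icc 1 ⌊Y⌋₊, |a₁ k| * ellp Y k ^ i) * (B * (Real.log Y ^ j * (3 * C * Real.sqrt (2 * α * K₁ * Y)))) ≤
      (∑ k ∈ Icc 1 ⌊Y⌋₊, |a₁ k| * ellp Y k ^ i) * (B * (Real.log Y ^ j * (3 * C₀ * Real.sqrt (2 * α * K₁ * Y)))) := by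
    intro C hC
    have hLj : 0 ≤ Real.log Y ^ j := pow_nonneg hLY j
    gcongr
  -- enlarge the constant of the second term (monotone in `C ≥ 0`)
  have hsecond : ∀ {C : ℝ} {N : ℕ}, 0 ≤ C → C ≤ C₀ →
      (∑ k ∈ Icc 1 ⌊Y⌋₊, |a₂ k| * ellp Y k ^ j) * ((2 * η) * (Real.log Y ^ i *
          (3 * (C + C * (1 + |Real.log (2 * α * Y ^ 2)|) ^ N) + 2 * C +
            C * (1 + |Real.log (2 * α * Y ^ 2)|) ^ N * (1 + |Real.log (2 * α * Y ^ 2)|)))) ≤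
      (∑ k ∈ Icc 1 ⌊Y⌋₊, |a₂ k| * ellp Y k ^ j) * ((2 * η) * (Real.log Y ^ i *
          (3 * (C₀ + C₀ * (1 + |Real.log (2 * α * Y ^ 2)|) ^ N) + 2 * C₀ +
            C₀ * (1 + |Real.log (2 * α * Y ^ 2)|) ^ N * (1 + |Real.log (2 * α * Y ^ 2)|)))) := by
    intro C N hC hCC
    have hLi : 0 ≤ Real.log Y ^ i := pow_nonneg hLY i
    have hxN : 0 ≤ (1 + |Real.log (2 * α * Y ^ 2)|) ^ N := pow_nonneg (by positivity) N
    gcongr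
  -- the simp set turning the KMV polynomial part into `Π_ab`
  refine ⟨?_, ?_, ?_, ?_⟩
  · have h := h₀₀ a₁ a₂ Y α B η K₁ i j hY hα hi hj hB hη hY₁
    have h' := le_trans h (add_le_add (hfirst e₀₀) (hsecond hC₀₀ e₀₀))
    have h'' := weaken_second_term hSj hη0 hLY hC₀0 hx (by norm_num : 0 + 0 + 1 ≤ 3) h'
    refine le_trans (le_of_eq ?_) h''
    congr 1
    refine Finset.sum_congr rfl fun k₁ _ ↦ Finset.sum_congr rfl fun k₂ _ ↦ ?_
    simp only [Finset.sum_range_succ, Finset.sum_range_zero, zero_add, add_zero, Nat.choose_self,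
      Nat.cast_one, Nat.sub_self, Nat.cast_zero, Nat.cast_add, pow_zero, pow_one,
      one_mul, mul_one, integral_model_weight_Ioc]
    ring
  · have h := h₀₁ a₁ a₂ Y α B η K₁ i j hY hα hi hj hB hη hY₁
    have h' := le_trans h (add_le_add (hfirst e₀₁) (hsecond hC₀₁ e₀₁))
    have h'' := weaken_second_term hSj hη0 hLY hC₀0 hx (by norm_num : 0 + 1 + 1 ≤ 3) h'
    refine le_trans (le_of_eq ?_) h''
    congr 1
    refine Finset.sum_congr rfl fun k₁ _ ↦ Finset.sum_congr rfl fun k₂ _ ↦ ?_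
    simp only [Finset.sum_range_succ, Finset.sum_range_zero, zero_add, add_zero, Nat.choose_self,
      Nat.choose_zero_right, Nat.cast_one, Nat.sub_self, Nat.sub_zero, Nat.cast_zero, Nat.cast_add, pow_zero, pow_one,
      one_mul, mul_one, integral_model_weight_Ioc]
    ring
  · have h := h₁₀ a₁ a₂ Y α B η K₁ i j hY hα hi hj hB hη hY₁
    have h' := le_trans h (add_le_add (hfirst e₁₀) (hsecond hC₁₀ e₁₀))
    have h'' := weaken_second_term hSj hη0 hLY hC₀0 hx (by norm_num : 1 + 0 + 1 ≤ 3) h'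
    refine le_trans (le_of_eq ?_) h''
    congr 1
    refine Finset.sum_congr rfl fun k₁ _ ↦ Finset.sum_congr rfl fun k₂ _ ↦ ?_
    simp only [Finset.sum_range_succ, Finset.sum_range_zero, zero_add, add_zero, Nat.choose_self,
      Nat.choose_zero_right, Nat.cast_one, Nat.sub_self, Nat.sub_zero, Nat.cast_zero, Nat.cast_add, pow_zero, pow_one,
      one_mul, mul_one, integral_model_weight_Ioc]
    ring
  · have h := h₁₁ a₁ a₂ Y α B η K₁ i j hY hα hi hj hB hη hY₁
    have h' := le_trans h (add_le_add (hfirst e₁₁) (hsecond hC₁₁ e₁₁))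
    have h'' := weaken_second_term hSj hη0 hLY hC₀0 hx (by norm_num : 1 + 1 + 1 ≤ 3) h'
    refine le_trans (le_of_eq ?_) h''
    congr 1
    refine Finset.sum_congr rfl fun k₁ _ ↦ Finset.sum_congr rfl fun k₂ _ ↦ ?_
    simp only [Finset.sum_range_succ, Finset.sum_range_zero, zero_add, add_zero, Nat.choose_self,
      Nat.choose_zero_right, Nat.cast_one, Nat.sub_self, Nat.sub_zero, Nat.cast_zero, Nat.cast_add, pow_zero, pow_one,
      one_mul, mul_one, integral_model_weight_Ioc]
    ring

end Summit.Parity.GeneralizedHardyLittlewood.Theorems.MomentsBeyondDiagonal.DiagCorner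

end
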